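import Summits.BirchSwinnertonDyer.Rank1Residual.GaloisImage.VisibleIndexBudgetPilot
import HarnessLib

/-!
# T-IDX27-REC (FILE 10): `Ш(E)[3] ≠ 0` for the PASS-rank3 rows `449352l1 ~ 449352b1`, `456201b1 ~ 456201a1`, `469989i1 ~ 325377a1` by the COUNT road with
# kernel index certificates `27 ≤ [E′(ℚ):3E′(ℚ)]` (team n1011, seat p17 lineage, row T-IDX27-REC; D15's shape)

HONEST FRAMING (cell `b2b-bsdres`, run/shared/lean/b2b/bsd-rank1-residual/, verbatim in every
file): the goal of the cell is to DELETE the COMBINATION-SHAPED residual classes of the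
Birch–Swinnerton-Dyer formula for ALL analytic-rank `≤ 1` elliptic curves over `ℚ` — "full BSD
formula for every rank `≤ 1` curve in class `C`" assembled STRICTLY from published theorems — so
that the rank-`≤ 1` remainder becomes exactly the CONSTRUCTION-SHAPED classes, which are TYPED
(missing-input `Prop`s), NOT attempted. This is not "finishing BSD". Team n1011 (N10/N11): research
route; this file is a set of per-pair KERNEL INSTANCES (EVIDENCE level: each record proves
`Ш(E)[3] ≠ 0` for ONE pair GIVEN `θ`, finiteness and coprimality — it closes nothing by itself; the
BSDp record with its EVIDENCE binders is the records lanes'); nothing is booked; no mark / label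
moved; X4 stays CONSTRUCTION-SHAPED. THEOREMS only; no definition, no named fact, no `sorry`.

## What

For each of r1's PASS-rank3 rows `E ~ E′` below (`route1/g29_cvis_pairs.tsv`: `E` an X4 curve with
`r_an = 0`, `E′` a `3`-congruent partner of Mordell–Weil rank `3`; inputs
`HOME/b2b-bsdres-n1011-p17/gen9/census/T-IDX27-PASSRANK3-INPUTS.md`, all 27/27 specified; the two
pilot rows are FILE D15 `GaloisImage/VisibleIndexBudgetPilot.lean`), token-for-token the pilot's recipe:
* ONE index instance `twentyseven_le_index_<E′>` — `27 ≤ [E′(ℚ):3E′(ℚ)]` by FILE D11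
  `twentyseven_le_index_range_zsmul_three_of_checks` from three Cremona generators, the ten compound
  points and thirteen NO-prime certificates `threeNonDivCheckAt … = true` (`decide +kernel`), the
  thirteen points checked ON the curve by `norm_num`;
* ONE record `exists_sha_three_torsion_<E>` over FILE D13
  `exists_sha_three_torsion_of_congr_of_index_of_primeList`: `L ⊇ primes(Δ_E Δ_E′) ∪ {3}` by x11c's
  factorisation certificates `X11b.forall_mem_of_natAbs_eq_prod_pow`, `#E′(ℚ_q)[3] = 1` at the free
  places `q ≠ 3` by T-LOC3L FILE L5 certificates (`threeTorsionCheckAt … = some 0`), the costly place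
  `3` by FILE D14 `natCard_ker_nsmul_three_adicCompletion_le_three_at3` (`μ₃(ℚ₃) = 1`, Weil pairing —
  no certificate, `t = 3`), budget `3 · 3 = 9 < 27`.
Displayed (NOT discharged): `θ : E′[3] ≅ E[3]` with `hθ`, `Finite E(ℚ)`, `(#E(ℚ), 3) = 1` — the
binder list is exactly the pilot's `(W W′ hW hW′ θ hθ hfin hcop)`.

Rows in this file: `449352l1 ~ 449352b1` (`E₀ = [0, 0, 0, -486798, -130655335]`, `F₀ = [0, 0, 0, -6636, 208244]`, `L = [2, 3, 79]`); `456201b1 ~ 456201a1` (`E₀ = [1, -1, 0, -9501, -354088]`, `F₀ = [0, 0, 1, 3, 56]`, `L = [3, 173, 293]`); `469989i1 ~ 325377a1` (`E₀ = [1, -1, 1, 4531, -184102]`, `F₀ = [1, -1, 1, -218, 2998]`, `L = [3, 13, 103]`).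

References: [CremonaMazur2000] §3; [AgasheStein2002] Thm. 3.1; [Cremona2006] (labels).
-/

set_option autoImplicit false

open WeierstrassCurve NumberField IsDedekindDomain Rat.HeightOneSpectrum Field
  Literature.NumberTheory.EllipticCurves Literature.NumberTheory.GaloisRepresentations
open Summit.BirchSwinnertonDyer.Rank1Residual.GaloisImage.LocalTorsion3At
  (threeTorsionCheckAt natCard_ker_nsmul_three_adicCompletion_eq_of_checkAt)
open Summit.BirchSwinnertonDyer.Rank1Residual

namespace Summit.BirchSwinnertonDyer.Rank1Residual.GaloisImage.DivisionDecider

/-- **Index instance `449352b1`** (`[0, 0, 0, -6636, 208244]`, Cremona rank 3; r1 PASS-rank3 row `449352l1 ~ 449352b1`):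
generators `(46, 18)`, `(49, 27)`, `(22, 270)`, the ten compound points `P₁±P₂, P₁±P₃, P₂±P₃, (P₁+P₂)±P₃,
(P₁−P₂)±P₃` and thirteen NO-primes `[3, 3, 3, 31, 3, 3, 19, 19, 3, 3, 3, 19, 3]` (census `gen9/census/idx27_certs.json`); the
thirteen points checked ON the curve by `norm_num` (`nonsingular_of_eq`), chords and certificates by
`decide +kernel` after `clear d`. [folklore] -/
theorem twentyseven_le_index_449352b1 (W' : WeierstrassCurve ℚ) [W'.IsElliptic]
    (hW' : W' = ⟨0, 0, 0, -6636, 208244⟩) (d : DecidableEq ℚ) :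
    27 ≤ (letI : DecidableEq ℚ := d
      (zsmulAddGroupHom ((3 : ℕ) : ℤ) : W'.toAffine.Point →+ W'.toAffine.Point).range.index) :=
  twentyseven_le_index_range_zsmul_three_of_checks 0 0 0 (-6636) 208244 W' hW'
    (x₁ := 46) (y₁ := 18) (x₂ := 49) (y₂ := 27)
    (x₃ := 22) (y₃ := 270)
    (u₁ := (-86)) (v₁ := 378)
    (u₂ := 130) (v₂ := 1242)
    (u₃ := (169 / 4)) (v₃ := (-459 / 8))
    (u₄ := 76) (v₄ := (-378))
    (u₅ := 10) (v₅ := (-378))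
    (u₆ := 50) (v₆ := (-38))
    (u₇ := 65) (v₇ := (-227))
    (u₈ := 100) (v₈ := 738)
    (u₉ := (-71)) (v₉ := 567)
    (u₁₀ := 44) (v₁₀ := (-38))
    (nonsingular_of_eq W' (by clear d; subst hW'; norm_num))
    (nonsingular_of_eq W' (by clear d; subst hW'; norm_num))
    (nonsingular_of_eq W' (by clear d; subst hW'; norm_num))
    (nonsingular_of_eq W' (by clear d; subst hW'; norm_num))
    (nonsingular_of_eq W' (by clear d; subst hW'; norm_num))
    (nonsingular_of_eq W' (by clear d; subst hW'; norm_num))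
    (nonsingular_of_eq W' (by clear d; subst hW'; norm_num))
    (nonsingular_of_eq W' (by clear d; subst hW'; norm_num))
    (nonsingular_of_eq W' (by clear d; subst hW'; norm_num))
    (nonsingular_of_eq W' (by clear d; subst hW'; norm_num))
    (nonsingular_of_eq W' (by clear d; subst hW'; norm_num))
    (nonsingular_of_eq W' (by clear d; subst hW'; norm_num))
    (nonsingular_of_eq W' (by clear d; subst hW'; norm_num))
    (by norm_num) (by norm_num) (by norm_num) (by norm_num) (by norm_num)
    (by clear d; subst hW'; decide +kernel) (by clear d; subst hW'; decide +kernel)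
    (by clear d; subst hW'; decide +kernel) (by clear d; subst hW'; decide +kernel)
    (by clear d; subst hW'; decide +kernel) (by clear d; subst hW'; decide +kernel)
    (by clear d; subst hW'; decide +kernel) (by clear d; subst hW'; decide +kernel)
    (by clear d; subst hW'; decide +kernel) (by clear d; subst hW'; decide +kernel)
    (by clear d; subst hW'; decide +kernel) (by clear d; subst hW'; decide +kernel)
    (by clear d; subst hW'; decide +kernel) (by clear d; subst hW'; decide +kernel)
    (by clear d; subst hW'; decide +kernel) (by clear d; subst hW'; decide +kernel)
    (by clear d; subst hW'; decide +kernel) (by clear d; subst hW'; decide +kernel)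
    (by clear d; subst hW'; decide +kernel) (by clear d; subst hW'; decide +kernel)
    (ℓ₁ := 3) (ℓ₂ := 3) (ℓ₃ := 3) (ℓ₄ := 31) (ℓ₅ := 3) (ℓ₆ := 3) (ℓ₇ := 19) (ℓ₈ := 19) (ℓ₉ := 3) (ℓ₁₀ := 3) (ℓ₁₁ := 3) (ℓ₁₂ := 19) (ℓ₁₃ := 3)
    (hℓ₁ := ⟨Nat.prime_three⟩) (hℓ₂ := ⟨Nat.prime_three⟩) (hℓ₃ := ⟨Nat.prime_three⟩)
    (hℓ₄ := ⟨by norm_num⟩) (hℓ₅ := ⟨Nat.prime_three⟩) (hℓ₆ := ⟨Nat.prime_three⟩)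
    (hℓ₇ := ⟨by norm_num⟩) (hℓ₈ := ⟨by norm_num⟩) (hℓ₉ := ⟨Nat.prime_three⟩)
    (hℓ₁₀ := ⟨Nat.prime_three⟩) (hℓ₁₁ := ⟨Nat.prime_three⟩) (hℓ₁₂ := ⟨by norm_num⟩)
    (hℓ₁₃ := ⟨Nat.prime_three⟩)
    (k₁ := 3) (k₂ := 3) (k₃ := 3) (k₄ := 1) (k₅ := 3) (k₆ := 3) (k₇ := 1) (k₈ := 1) (k₉ := 3) (k₁₀ := 3) (k₁₁ := 3) (k₁₂ := 1) (k₁₃ := 3)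
    (by decide +kernel) (by decide +kernel) (by decide +kernel) (by decide +kernel)
    (by decide +kernel) (by decide +kernel) (by decide +kernel) (by decide +kernel)
    (by decide +kernel) (by decide +kernel) (by decide +kernel) (by decide +kernel)
    (by decide +kernel) d

/-- **T-IDX27-REC `449352l1 ~ 449352b1` (PASS-rank3, `L = [2, 3, 79]`): `Ш(E/ℚ)[3] ≠ 0` in the `hvis` currency** from
`θ`, `Finite E(ℚ)`, coprimality — everything else decided in the kernel: factorisation certificates
(`|Δ(E₀)| = 2^4·3^3·79^7`, `|Δ(F₀)| = 2^8·3^9·79^2`), `#E′(ℚ_q)[3] = 1` at `q ∈ [2, 79]` by T-LOC3L L5 certificates, the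
place `3` by D14 (`μ₃(ℚ₃) = 1`, `t = 3`), the index certificate `twentyseven_le_index_449352b1`, budget `3·3 < 27`.
[cite: CremonaMazur2000, §3 pp. 19–22] [cite: Cremona2006, Table 1 (Cremona labels 449352l1, 449352b1)] -/
theorem exists_sha_three_torsion_449352l1 (W W' : WeierstrassCurve ℚ) [W.IsElliptic] [W'.IsElliptic]
    (hW : W = ⟨0, 0, 0, -486798, -130655335⟩) (hW' : W' = ⟨0, 0, 0, -6636, 208244⟩)
    (θ : geomTorsion W' ((3 : ℕ) : ℤ) ≃+ geomTorsion W ((3 : ℕ) : ℤ))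
    (hθ : ∀ (σ : Field.absoluteGaloisGroup ℚ) (P : geomTorsion W' ((3 : ℕ) : ℤ)),
      θ (σ • P) = σ • θ P)
    (hfin : Finite W.toAffine.Point) (hcop : (Nat.card W.toAffine.Point).Coprime 3) :
    ∃ c : W.sha, c ≠ 0 ∧ (3 : ℕ) • c = 0 := by
  haveI : Fact (Nat.Prime 2) := ⟨Nat.prime_two⟩
  haveI : Fact (Nat.Prime 79) := ⟨by norm_num⟩
  have hidx := twentyseven_le_index_449352b1 W' hW' (fun a b => Classical.propDecidable (a = b))
  refine exists_sha_three_torsion_of_congr_of_index_of_primeList W W' θ hθ hfin hcop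
    (E₀ := ⟨0, 0, 0, -486798, -130655335⟩) (F₀ := ⟨0, 0, 0, -6636, 208244⟩)
    (by subst hW; ext <;> simp [WeierstrassCurve.map])
    (by subst hW'; ext <;> simp [WeierstrassCurve.map])
    [2, 3, 79] (by decide)
    (X11b.forall_mem_of_natAbs_eq_prod_pow [2, 3, 79] [4, 3, 7]
      (by intro q hq; simp only [List.mem_cons, List.mem_nil_iff, or_false] at hq; rcases hq with rfl | rfl | rfl <;> norm_num)
      (by decide +kernel))
    (X11b.forall_mem_of_natAbs_eq_prod_pow [2, 3, 79] [8, 9, 2]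
      (by intro q hq; simp only [List.mem_cons, List.mem_nil_iff, or_false] at hq; rcases hq with rfl | rfl | rfl <;> norm_num)
      (by decide +kernel))
    Nat.prime_three (by decide) (t := 3)
    (fun v hv => natCard_ker_nsmul_three_adicCompletion_le_three_at3 W' hv)
    (fun v hvL hv3 => ?_) (m := 27) (by norm_num) hidx
  have hcases : (primesEquiv v : ℕ) = 2 ∨ (primesEquiv v : ℕ) = 79 := by
    simp only [List.mem_cons, List.mem_nil_iff, or_false] at hvL
    omega
  rcases hcases with h2 | h79
  · exact (natCard_ker_nsmul_three_adicCompletion_eq_of_checkAt 2 0 0 0 (-6636) 208244 (by norm_num)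
      (by decide) (k := 2) (S := 0) (cert := []) (by decide +kernel) W' hW' h2).trans
      (by norm_num)
  · exact (natCard_ker_nsmul_three_adicCompletion_eq_of_checkAt 79 0 0 0 (-6636) 208244 (by norm_num)
      (by decide) (k := 2) (S := 0) (cert := [((301385 : ℤ), 1, 3, 1)]) (by decide +kernel) W' hW' h79).trans
      (by norm_num)

/-- **Index instance `456201a1`** (`[0, 0, 1, 3, 56]`, Cremona rank 3; r1 PASS-rank3 row `456201b1 ~ 456201a1`):
generators `(0, 7)`, `(-3, 4)`, `(-2, 6)`, the ten compound points `P₁±P₂, P₁±P₃, P₂±P₃, (P₁+P₂)±P₃,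
(P₁−P₂)±P₃` and thirteen NO-primes `[3, 7, 3, 3, 3, 3, 7, 3, 3, 3, 7, 3, 13]` (census `gen9/census/idx27_certs.json`); the
thirteen points checked ON the curve by `norm_num` (`nonsingular_of_eq`), chords and certificates by
`decide +kernel` after `clear d`. [folklore] -/
theorem twentyseven_le_index_456201a1 (W' : WeierstrassCurve ℚ) [W'.IsElliptic]
    (hW' : W' = ⟨0, 0, 1, 3, 56⟩) (d : DecidableEq ℚ) :
    27 ≤ (letI : DecidableEq ℚ := d
      (zsmulAddGroupHom ((3 : ℕ) : ℤ) : W'.toAffine.Point →+ W'.toAffine.Point).range.index) :=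
  twentyseven_le_index_range_zsmul_three_of_checks 0 0 1 3 56 W' hW'
    (x₁ := 0) (y₁ := 7) (x₂ := (-3)) (y₂ := 4)
    (x₃ := (-2)) (y₃ := 6)
    (u₁ := 4) (v₁ := (-12))
    (u₂ := 19) (v₂ := (-84))
    (u₃ := (9 / 4)) (v₃ := (-73 / 8))
    (u₄ := 51) (v₄ := (-365))
    (u₅ := 9) (v₅ := (-29))
    (u₆ := 126) (v₆ := 1414)
    (u₇ := 7) (v₇ := 20)
    (u₈ := (-47 / 36)) (v₈ := (1421 / 216))
    (u₉ := (67 / 49)) (v₉ := (2549 / 343))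
    (u₁₀ := (-32 / 9)) (v₁₀ := (8 / 27))
    (nonsingular_of_eq W' (by clear d; subst hW'; norm_num))
    (nonsingular_of_eq W' (by clear d; subst hW'; norm_num))
    (nonsingular_of_eq W' (by clear d; subst hW'; norm_num))
    (nonsingular_of_eq W' (by clear d; subst hW'; norm_num))
    (nonsingular_of_eq W' (by clear d; subst hW'; norm_num))
    (nonsingular_of_eq W' (by clear d; subst hW'; norm_num))
    (nonsingular_of_eq W' (by clear d; subst hW'; norm_num))
    (nonsingular_of_eq W' (by clear d; subst hW'; norm_num))
    (nonsingular_of_eq W' (by clear d; subst hW'; norm_num))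
    (nonsingular_of_eq W' (by clear d; subst hW'; norm_num))
    (nonsingular_of_eq W' (by clear d; subst hW'; norm_num))
    (nonsingular_of_eq W' (by clear d; subst hW'; norm_num))
    (nonsingular_of_eq W' (by clear d; subst hW'; norm_num))
    (by norm_num) (by norm_num) (by norm_num) (by norm_num) (by norm_num)
    (by clear d; subst hW'; decide +kernel) (by clear d; subst hW'; decide +kernel)
    (by clear d; subst hW'; decide +kernel) (by clear d; subst hW'; decide +kernel)
    (by clear d; subst hW'; decide +kernel) (by clear d; subst hW'; decide +kernel)
    (by clear d; subst hW'; decide +kernel) (by clear d; subst hW'; decide +kernel)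
    (by clear d; subst hW'; decide +kernel) (by clear d; subst hW'; decide +kernel)
    (by clear d; subst hW'; decide +kernel) (by clear d; subst hW'; decide +kernel)
    (by clear d; subst hW'; decide +kernel) (by clear d; subst hW'; decide +kernel)
    (by clear d; subst hW'; decide +kernel) (by clear d; subst hW'; decide +kernel)
    (by clear d; subst hW'; decide +kernel) (by clear d; subst hW'; decide +kernel)
    (by clear d; subst hW'; decide +kernel) (by clear d; subst hW'; decide +kernel)
    (ℓ₁ := 3) (ℓ₂ := 7) (ℓ₃ := 3) (ℓ₄ := 3) (ℓ₅ := 3) (ℓ₆ := 3) (ℓ₇ := 7) (ℓ₈ := 3) (ℓ₉ := 3) (ℓ₁₀ := 3) (ℓ₁₁ := 7) (ℓ₁₂ := 3) (ℓ₁₃ := 13)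
    (hℓ₁ := ⟨Nat.prime_three⟩) (hℓ₂ := ⟨by norm_num⟩) (hℓ₃ := ⟨Nat.prime_three⟩)
    (hℓ₄ := ⟨Nat.prime_three⟩) (hℓ₅ := ⟨Nat.prime_three⟩) (hℓ₆ := ⟨Nat.prime_three⟩)
    (hℓ₇ := ⟨by norm_num⟩) (hℓ₈ := ⟨Nat.prime_three⟩) (hℓ₉ := ⟨Nat.prime_three⟩)
    (hℓ₁₀ := ⟨Nat.prime_three⟩) (hℓ₁₁ := ⟨by norm_num⟩) (hℓ₁₂ := ⟨Nat.prime_three⟩)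
    (hℓ₁₃ := ⟨by norm_num⟩)
    (k₁ := 1) (k₂ := 1) (k₃ := 1) (k₄ := 1) (k₅ := 1) (k₆ := 1) (k₇ := 1) (k₈ := 1) (k₉ := 1) (k₁₀ := 1) (k₁₁ := 1) (k₁₂ := 1) (k₁₃ := 1)
    (by decide +kernel) (by decide +kernel) (by decide +kernel) (by decide +kernel)
    (by decide +kernel) (by decide +kernel) (by decide +kernel) (by decide +kernel)
    (by decide +kernel) (by decide +kernel) (by decide +kernel) (by decide +kernel)
    (by decide +kernel) d

/-- **T-IDX27-REC `456201b1 ~ 456201a1` (PASS-rank3, `L = [3, 173, 293]`): `Ш(E/ℚ)[3] ≠ 0` in the `hvis` currency** from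
`θ`, `Finite E(ℚ)`, coprimality — everything else decided in the kernel: factorisation certificates
(`|Δ(E₀)| = 3^6·173^1·293^1`, `|Δ(F₀)| = 3^3·173^1·293^1`), `#E′(ℚ_q)[3] = 1` at `q ∈ [173, 293]` by T-LOC3L L5 certificates, the
place `3` by D14 (`μ₃(ℚ₃) = 1`, `t = 3`), the index certificate `twentyseven_le_index_456201a1`, budget `3·3 < 27`.
[cite: CremonaMazur2000, §3 pp. 19–22] [cite: Cremona2006, Table 1 (Cremona labels 456201b1, 456201a1)] -/
theorem exists_sha_three_torsion_456201b1 (W W' : WeierstrassCurve ℚ) [W.IsElliptic] [W'.IsElliptic]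
    (hW : W = ⟨1, -1, 0, -9501, -354088⟩) (hW' : W' = ⟨0, 0, 1, 3, 56⟩)
    (θ : geomTorsion W' ((3 : ℕ) : ℤ) ≃+ geomTorsion W ((3 : ℕ) : ℤ))
    (hθ : ∀ (σ : Field.absoluteGaloisGroup ℚ) (P : geomTorsion W' ((3 : ℕ) : ℤ)),
      θ (σ • P) = σ • θ P)
    (hfin : Finite W.toAffine.Point) (hcop : (Nat.card W.toAffine.Point).Coprime 3) :
    ∃ c : W.sha, c ≠ 0 ∧ (3 : ℕ) • c = 0 := by
  haveI : Fact (Nat.Prime 173) := ⟨by norm_num⟩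
  haveI : Fact (Nat.Prime 293) := ⟨by norm_num⟩
  have hidx := twentyseven_le_index_456201a1 W' hW' (fun a b => Classical.propDecidable (a = b))
  refine exists_sha_three_torsion_of_congr_of_index_of_primeList W W' θ hθ hfin hcop
    (E₀ := ⟨1, -1, 0, -9501, -354088⟩) (F₀ := ⟨0, 0, 1, 3, 56⟩)
    (by subst hW; ext <;> simp [WeierstrassCurve.map])
    (by subst hW'; ext <;> simp [WeierstrassCurve.map])
    [3, 173, 293] (by decide)
    (X11b.forall_mem_of_natAbs_eq_prod_pow [3, 173, 293] [6, 1, 1]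
      (by intro q hq; simp only [List.mem_cons, List.mem_nil_iff, or_false] at hq; rcases hq with rfl | rfl | rfl <;> norm_num)
      (by decide +kernel))
    (X11b.forall_mem_of_natAbs_eq_prod_pow [3, 173, 293] [3, 1, 1]
      (by intro q hq; simp only [List.mem_cons, List.mem_nil_iff, or_false] at hq; rcases hq with rfl | rfl | rfl <;> norm_num)
      (by decide +kernel))
    Nat.prime_three (by decide) (t := 3)
    (fun v hv => natCard_ker_nsmul_three_adicCompletion_le_three_at3 W' hv)
    (fun v hvL hv3 => ?_) (m := 27) (by norm_num) hidx
  have hcases : (primesEquiv v : ℕ) = 173 ∨ (primesEquiv v : ℕ) = 293 := by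
    simp only [List.mem_cons, List.mem_nil_iff, or_false] at hvL
    omega
  rcases hcases with h173 | h293
  · exact (natCard_ker_nsmul_three_adicCompletion_eq_of_checkAt 173 0 0 1 3 56 (by norm_num)
      (by decide) (k := 1) (S := 0) (cert := [((106 : ℤ), 0, 1, 0)]) (by decide +kernel) W' hW' h173).trans
      (by norm_num)
  · exact (natCard_ker_nsmul_three_adicCompletion_eq_of_checkAt 293 0 0 1 3 56 (by norm_num)
      (by decide) (k := 1) (S := 0) (cert := [((121 : ℤ), 0, 1, 0)]) (by decide +kernel) W' hW' h293).trans
      (by norm_num)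

/-- **Index instance `325377a1`** (`[1, -1, 1, -218, 2998]`, Cremona rank 3; r1 PASS-rank3 row `469989i1 ~ 325377a1`):
generators `(16, 50)`, `(-2, 59)`, `(133, 1454)`, the ten compound points `P₁±P₂, P₁±P₃, P₂±P₃, (P₁+P₂)±P₃,
(P₁−P₂)±P₃` and thirteen NO-primes `[3, 3, 3, 3, 3, 3, 3, 7, 3, 3, 3, 3, 3]` (census `gen9/census/idx27_certs.json`); the
thirteen points checked ON the curve by `norm_num` (`nonsingular_of_eq`), chords and certificates by
`decide +kernel` after `clear d`. [folklore] -/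
theorem twentyseven_le_index_325377a1 (W' : WeierstrassCurve ℚ) [W'.IsElliptic]
    (hW' : W' = ⟨1, -1, 1, -218, 2998⟩) (d : DecidableEq ℚ) :
    27 ≤ (letI : DecidableEq ℚ := d
      (zsmulAddGroupHom ((3 : ℕ) : ℤ) : W'.toAffine.Point →+ W'.toAffine.Point).range.index) :=
  twentyseven_le_index_range_zsmul_three_of_checks 1 (-1) 1 (-218) 2998 W' hW'
    (x₁ := 16) (y₁ := 50) (x₂ := (-2)) (y₂ := 59)
    (x₃ := 133) (y₃ := 1454)
    (u₁ := (-53 / 4)) (v₁ := (-419 / 8))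
    (u₂ := 29) (v₂ := (-158))
    (u₃ := 8) (v₃ := 37)
    (u₄ := 34) (v₄ := 167)
    (u₅ := (-116 / 9)) (v₅ := (1766 / 27))
    (u₆ := (166 / 25)) (v₆ := (4846 / 125))
    (u₇ := (-59 / 25)) (v₇ := (-7304 / 125))
    (u₈ := (-19)) (v₈ := 10)
    (u₉ := (379 / 4)) (v₉ := (-7655 / 8))
    (u₁₀ := (229 / 16)) (v₁₀ := (-3793 / 64))
    (nonsingular_of_eq W' (by clear d; subst hW'; norm_num))
    (nonsingular_of_eq W' (by clear d; subst hW'; norm_num))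
    (nonsingular_of_eq W' (by clear d; subst hW'; norm_num))
    (nonsingular_of_eq W' (by clear d; subst hW'; norm_num))
    (nonsingular_of_eq W' (by clear d; subst hW'; norm_num))
    (nonsingular_of_eq W' (by clear d; subst hW'; norm_num))
    (nonsingular_of_eq W' (by clear d; subst hW'; norm_num))
    (nonsingular_of_eq W' (by clear d; subst hW'; norm_num))
    (nonsingular_of_eq W' (by clear d; subst hW'; norm_num))
    (nonsingular_of_eq W' (by clear d; subst hW'; norm_num))
    (nonsingular_of_eq W' (by clear d; subst hW'; norm_num))
    (nonsingular_of_eq W' (by clear d; subst hW'; norm_num))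
    (nonsingular_of_eq W' (by clear d; subst hW'; norm_num))
    (by norm_num) (by norm_num) (by norm_num) (by norm_num) (by norm_num)
    (by clear d; subst hW'; decide +kernel) (by clear d; subst hW'; decide +kernel)
    (by clear d; subst hW'; decide +kernel) (by clear d; subst hW'; decide +kernel)
    (by clear d; subst hW'; decide +kernel) (by clear d; subst hW'; decide +kernel)
    (by clear d; subst hW'; decide +kernel) (by clear d; subst hW'; decide +kernel)
    (by clear d; subst hW'; decide +kernel) (by clear d; subst hW'; decide +kernel)
    (by clear d; subst hW'; decide +kernel) (by clear d; subst hW'; decide +kernel)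
    (by clear d; subst hW'; decide +kernel) (by clear d; subst hW'; decide +kernel)
    (by clear d; subst hW'; decide +kernel) (by clear d; subst hW'; decide +kernel)
    (by clear d; subst hW'; decide +kernel) (by clear d; subst hW'; decide +kernel)
    (by clear d; subst hW'; decide +kernel) (by clear d; subst hW'; decide +kernel)
    (ℓ₁ := 3) (ℓ₂ := 3) (ℓ₃ := 3) (ℓ₄ := 3) (ℓ₅ := 3) (ℓ₆ := 3) (ℓ₇ := 3) (ℓ₈ := 7) (ℓ₉ := 3) (ℓ₁₀ := 3) (ℓ₁₁ := 3) (ℓ₁₂ := 3) (ℓ₁₃ := 3)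
    (hℓ₁ := ⟨Nat.prime_three⟩) (hℓ₂ := ⟨Nat.prime_three⟩) (hℓ₃ := ⟨Nat.prime_three⟩)
    (hℓ₄ := ⟨Nat.prime_three⟩) (hℓ₅ := ⟨Nat.prime_three⟩) (hℓ₆ := ⟨Nat.prime_three⟩)
    (hℓ₇ := ⟨Nat.prime_three⟩) (hℓ₈ := ⟨by norm_num⟩) (hℓ₉ := ⟨Nat.prime_three⟩)
    (hℓ₁₀ := ⟨Nat.prime_three⟩) (hℓ₁₁ := ⟨Nat.prime_three⟩) (hℓ₁₂ := ⟨Nat.prime_three⟩)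
    (hℓ₁₃ := ⟨Nat.prime_three⟩)
    (k₁ := 2) (k₂ := 2) (k₃ := 2) (k₄ := 2) (k₅ := 2) (k₆ := 2) (k₇ := 2) (k₈ := 1) (k₉ := 2) (k₁₀ := 2) (k₁₁ := 2) (k₁₂ := 2) (k₁₃ := 2)
    (by decide +kernel) (by decide +kernel) (by decide +kernel) (by decide +kernel)
    (by decide +kernel) (by decide +kernel) (by decide +kernel) (by decide +kernel)
    (by decide +kernel) (by decide +kernel) (by decide +kernel) (by decide +kernel)
    (by decide +kernel) d

/-- **T-IDX27-REC `469989i1 ~ 325377a1` (PASS-rank3, `L = [3, 13, 103]`): `Ш(E/ℚ)[3] ≠ 0` in the `hvis` currency** from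
`θ`, `Finite E(ℚ)`, coprimality — everything else decided in the kernel: factorisation certificates
(`|Δ(E₀)| = 3^5·13^8·103^1`, `|Δ(F₀)| = 3^11·13^2·103^1`), `#E′(ℚ_q)[3] = 1` at `q ∈ [13, 103]` by T-LOC3L L5 certificates, the
place `3` by D14 (`μ₃(ℚ₃) = 1`, `t = 3`), the index certificate `twentyseven_le_index_325377a1`, budget `3·3 < 27`.
[cite: CremonaMazur2000, §3 pp. 19–22] [cite: Cremona2006, Table 1 (Cremona labels 469989i1, 325377a1)] -/
theorem exists_sha_three_torsion_469989i1 (W W' : WeierstrassCurve ℚ) [W.IsElliptic] [W'.IsElliptic]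
    (hW : W = ⟨1, -1, 1, 4531, -184102⟩) (hW' : W' = ⟨1, -1, 1, -218, 2998⟩)
    (θ : geomTorsion W' ((3 : ℕ) : ℤ) ≃+ geomTorsion W ((3 : ℕ) : ℤ))
    (hθ : ∀ (σ : Field.absoluteGaloisGroup ℚ) (P : geomTorsion W' ((3 : ℕ) : ℤ)),
      θ (σ • P) = σ • θ P)
    (hfin : Finite W.toAffine.Point) (hcop : (Nat.card W.toAffine.Point).Coprime 3) :
    ∃ c : W.sha, c ≠ 0 ∧ (3 : ℕ) • c = 0 := by
  haveI : Fact (Nat.Prime 13) := ⟨by norm_num⟩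
  haveI : Fact (Nat.Prime 103) := ⟨by norm_num⟩
  have hidx := twentyseven_le_index_325377a1 W' hW' (fun a b => Classical.propDecidable (a = b))
  refine exists_sha_three_torsion_of_congr_of_index_of_primeList W W' θ hθ hfin hcop
    (E₀ := ⟨1, -1, 1, 4531, -184102⟩) (F₀ := ⟨1, -1, 1, -218, 2998⟩)
    (by subst hW; ext <;> simp [WeierstrassCurve.map])
    (by subst hW'; ext <;> simp [WeierstrassCurve.map])
    [3, 13, 103] (by decide)
    (X11b.forall_mem_of_natAbs_eq_prod_pow [3, 13, 103] [5, 8, 1]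
      (by intro q hq; simp only [List.mem_cons, List.mem_nil_iff, or_false] at hq; rcases hq with rfl | rfl | rfl <;> norm_num)
      (by decide +kernel))
    (X11b.forall_mem_of_natAbs_eq_prod_pow [3, 13, 103] [11, 2, 1]
      (by intro q hq; simp only [List.mem_cons, List.mem_nil_iff, or_false] at hq; rcases hq with rfl | rfl | rfl <;> norm_num)
      (by decide +kernel))
    Nat.prime_three (by decide) (t := 3)
    (fun v hv => natCard_ker_nsmul_three_adicCompletion_le_three_at3 W' hv)
    (fun v hvL hv3 => ?_) (m := 27) (by norm_num) hidx
  have hcases : (primesEquiv v : ℕ) = 13 ∨ (primesEquiv v : ℕ) = 103 := by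
    simp only [List.mem_cons, List.mem_nil_iff, or_false] at hvL
    omega
  rcases hcases with h13 | h103
  · exact (natCard_ker_nsmul_three_adicCompletion_eq_of_checkAt 13 1 (-1) 1 (-218) 2998 (by norm_num)
      (by decide) (k := 1) (S := 0) (cert := [((5 : ℤ), 0, 1, 0)]) (by decide +kernel) W' hW' h13).trans
      (by norm_num)
  · exact (natCard_ker_nsmul_three_adicCompletion_eq_of_checkAt 103 1 (-1) 1 (-218) 2998 (by norm_num)
      (by decide) (k := 1) (S := 0) (cert := [((40 : ℤ), 0, 1, 0)]) (by decide +kernel) W' hW' h103).trans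
      (by norm_num)

end Summit.BirchSwinnertonDyer.Rank1Residual.GaloisImage.DivisionDecider
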